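import Summits.ValiantsHypothesis.ValiantsHypothesis.Theorems.EquivariantDialBudgetRetract
import Summits.ValiantsHypothesis.ValiantsHypothesis.Theorems.EquivariantDialDiagonalPermify
import HarnessLib

/-!
# ValiantsHypothesis — the equivariant dial: THRESHOLD PERMIFY, file 2/5 — permutation embedding
# (iii″) and its diagonal inflation (iii′)_Δ at an ARBITRARY Young fixed-vector index budget `B`

Helper of `stmt-ValiantsHypothesis-23702` (`--as helper`; 0 definitions, 0 named facts, closes NO
item).  Decomposition workshop VALIANT, lens-1, g36, offer O-L1-28 «THRESHOLD PERMIFY».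

Transcriptions of two tree theorems with the quasi-polynomial budget replaced by a parameter `B`
and the small regime `n ≤ 4 (log₂ m₀ + 1)` carried as a disjunct:

* **`retract_of_budget`** ((iii″)_B, from `permEmbedding_of_irreducible`): a representation
  `ρ : G →* GL_{m₀} ℂ` of a finite `G ↠ 𝔖_n × 𝔖_n`, scalar on the kernel, unimodular, is — unless
  `n ≤ 4 (log₂ m₀ + 1)` — an equivariant retract of a permutation representation of degree
  `≤ m₀ · (4 m₀ B)`, provided every `𝔄_n × 𝔄_n →* GL_k ℂ`, `1 ≤ k ≤ m₀`, has a nonzero functional fixed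
  by a subgroup of index `≤ B` (complete reducibility + induction on the dimension, `linRetract_sum`,
  each irreducible block by `retractD_of_budget`);
* **`diagRetract_of_budget`** ((iii′)_Δ,B, from `permEmbeddingQP_diag`): the same for lift groups
  `F ≤ (𝔖_n × 𝔖_n) × GL_{m₀}` over the DIAGONAL `Δ𝔖_n`, by inflation `G × 𝔖_n ↠ 𝔖_n × 𝔖_n`.

HONEST BOUNDARY: 0 S-currency; closes NO item; infrastructure (no dial claim in this file); both
theorems are TRANSCRIPTIONS of tree proofs; `stmt-23702` / `VP ≠ VNP` untouched.
-/

noncomputable section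

set_option linter.dupNamespace false

namespace Summit.ValiantsHypothesis.ValiantsHypothesis.Theorems.EquivariantDialThresholdPermify

open Matrix
open Summit.ValiantsHypothesis.ValiantsHypothesis.Theorems.SymPencilEquivariantSdcNotQP
open Summit.ValiantsHypothesis.ValiantsHypothesis.Theorems.EquivariantDialDiagonalPermify

/-- **(iii″) at budget `B`.**  Transcription of `permEmbedding_of_irreducible`: after the case
`n ≤ 4 (log₂ m₀ + 1)` (left disjunct), Maschke induction on the dimension at the linear level
(`exists_invariant_compl`, `linRetract_sum`, `linRetract_reindex`, `linRetract_of_equiv`), each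
irreducible block of dimension `k ≤ m₀` embedded by `retractD_of_budget` (its small regime being
excluded) at cost `≤ 4 m₀ B`; at most `m₀` blocks. [folklore; transcription] -/
theorem retract_of_budget (n m₀ B : ℕ) (G : Type) [Group G] [Finite G]
    (φ : G →* Equiv.Perm (Fin n) × Equiv.Perm (Fin n)) (ρ : G →* GL (Fin m₀) ℂ)
    (hφ : Function.Surjective φ)
    (hker : ∀ g : G, φ g = 1 → ∃ c : ℂ,
      (ρ g : Matrix (Fin m₀) (Fin m₀) ℂ) = c • (1 : Matrix (Fin m₀) (Fin m₀) ℂ))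
    (hdet : ∀ g : G, Matrix.det (ρ g : Matrix (Fin m₀) (Fin m₀) ℂ) = 1)
    (hY : ∀ k : ℕ, 1 ≤ k → k ≤ m₀ →
      ∀ σ : ↥(alternatingGroup (Fin n)) × ↥(alternatingGroup (Fin n)) →* GL (Fin k) ℂ,
      ∃ Y : Subgroup (↥(alternatingGroup (Fin n)) × ↥(alternatingGroup (Fin n))),
        Y.index ≤ B ∧ ∃ ℓ : (Fin k → ℂ) →ₗ[ℂ] ℂ, ℓ ≠ 0 ∧
          ∀ y ∈ Y, ℓ ∘ₗ Matrix.toLin' (σ y : Matrix (Fin k) (Fin k) ℂ) = ℓ) :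
    n ≤ 4 * (Nat.log 2 m₀ + 1) ∨ ∃ m' ≤ m₀ * (4 * m₀ * B),
      ∃ (ι : Matrix (Fin m') (Fin m₀) ℂ) (p : Matrix (Fin m₀) (Fin m') ℂ) (τ : G → Equiv.Perm (Fin m')),
        p * ι = 1 ∧ ∀ g : G,
          (τ g).permMatrix ℂ * ι = ι * (ρ g : Matrix (Fin m₀) (Fin m₀) ℂ) ∧
          p * (τ g).permMatrix ℂ = (ρ g : Matrix (Fin m₀) (Fin m₀) ℂ) * p := by
  classical
  by_cases hlarge : n ≤ 4 * (Nat.log 2 m₀ + 1)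
  · exact Or.inl hlarge
  refine Or.inr ?_
  set Bd : ℕ := 4 * m₀ * B with hBd
  -- on the kernel: scalars with `c ^ m₀ = 1`
  have hkerM : ∀ g : G, φ g = 1 → ∃ c : ℂ, c ^ m₀ = 1 ∧
      (ρ g : Matrix (Fin m₀) (Fin m₀) ℂ) = c • (1 : Matrix (Fin m₀) (Fin m₀) ℂ) := by
    intro g hg
    obtain ⟨c, hc⟩ := hker g hg
    refine ⟨c, ?_, hc⟩
    have := hdet g
    rwa [hc, Matrix.det_smul, Matrix.det_one, mul_one, Fintype.card_fin] at this
  -- Maschke induction on the dimension, at the linear level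
  have key : ∀ (r : ℕ) (V : Type) [AddCommGroup V] [Module ℂ V] [FiniteDimensional ℂ V]
      (T : G →* (V →ₗ[ℂ] V)), Module.finrank ℂ V ≤ r → Module.finrank ℂ V ≤ m₀ →
      (∀ g : G, φ g = 1 → ∃ c : ℂ, c ^ m₀ = 1 ∧ T g = c • LinearMap.id) →
      ∃ (m' : ℕ) (ι : V →ₗ[ℂ] (Fin m' → ℂ)) (p : (Fin m' → ℂ) →ₗ[ℂ] V)
        (τ : G → Equiv.Perm (Fin m')),
        m' ≤ Module.finrank ℂ V * Bd ∧ p ∘ₗ ι = LinearMap.id ∧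
        ∀ g, LinearMap.funLeft ℂ ℂ (τ g) ∘ₗ ι = ι ∘ₗ T g ∧
          p ∘ₗ LinearMap.funLeft ℂ ℂ (τ g) = T g ∘ₗ p := by
    intro r
    induction r with
    | zero =>
      intro V _ _ _ T hr _ _
      haveI : Subsingleton V := Module.finrank_zero_iff.mp (Nat.le_zero.mp hr)
      refine ⟨0, 0, 0, fun _ => 1, le_rfl.trans (Nat.zero_le _), ?_, fun g => ⟨?_, ?_⟩⟩
      · exact LinearMap.ext fun v => Subsingleton.elim _ _
      · rw [LinearMap.comp_zero, LinearMap.zero_comp]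
      · rw [LinearMap.zero_comp, LinearMap.comp_zero]
    | succ r ih =>
      intro V _ _ _ T hr hM hsc
      by_cases hle : Module.finrank ℂ V ≤ r
      · exact ih V T hle hM hsc
      have hrk : Module.finrank ℂ V = r + 1 := by omega
      by_cases hirr : ∀ W : Submodule ℂ V, (∀ g, W ≤ W.comap (T g)) → W = ⊥ ∨ W = ⊤
      · -- irreducible: pass to matrices in a basis and use (D)_B
        set k : ℕ := Module.finrank ℂ V with hk
        let b : Module.Basis (Fin k) ℂ V := Module.finBasis ℂ V
        let ρV : G →* GL (Fin k) ℂ :=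
          (Units.map ((LinearMap.toMatrixAlgEquiv b :
            (V →ₗ[ℂ] V) ≃ₐ[ℂ] Matrix (Fin k) (Fin k) ℂ).toMonoidHom)).comp T.toHomUnits
        have hρV : ∀ g, (ρV g : Matrix (Fin k) (Fin k) ℂ) = LinearMap.toMatrix b b (T g) := fun g => rfl
        -- `b.equivFun ∘ T g = ρV g ∘ b.equivFun`
        have hconj : ∀ g, (b.equivFun : V ≃ₗ[ℂ] (Fin k → ℂ)).toLinearMap ∘ₗ T g =
            Matrix.toLin' (ρV g : Matrix (Fin k) (Fin k) ℂ) ∘ₗ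
              (b.equivFun : V ≃ₗ[ℂ] (Fin k → ℂ)).toLinearMap := by
          intro g
          refine LinearMap.ext fun v => ?_
          simp only [LinearMap.coe_comp, LinearEquiv.coe_coe, Function.comp_apply, hρV,
            Matrix.toLin'_apply, Module.Basis.equivFun_apply, LinearMap.toMatrix_mulVec_repr]
        have hconj' : ∀ g, (b.equivFun.symm : (Fin k → ℂ) ≃ₗ[ℂ] V).toLinearMap ∘ₗ
            Matrix.toLin' (ρV g : Matrix (Fin k) (Fin k) ℂ) =
              T g ∘ₗ (b.equivFun.symm : (Fin k → ℂ) ≃ₗ[ℂ] V).toLinearMap := by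
          intro g
          refine LinearMap.ext fun w => ?_
          have := LinearMap.congr_fun (hconj g) (b.equivFun.symm w)
          simp only [LinearMap.coe_comp, LinearEquiv.coe_coe, Function.comp_apply,
            LinearEquiv.apply_symm_apply] at this
          simp only [LinearMap.coe_comp, LinearEquiv.coe_coe, Function.comp_apply]
          rw [← this, LinearEquiv.symm_apply_apply]
        -- irreducibility in coordinates
        have hirr' : ∀ W : Submodule ℂ (Fin k → ℂ),
            (∀ g : G, W ≤ W.comap (Matrix.toLin' (ρV g : Matrix (Fin k) (Fin k) ℂ))) →
              W = ⊥ ∨ W = ⊤ := by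
          intro W hW
          have hWc : ∀ g, W.comap (b.equivFun : V ≃ₗ[ℂ] (Fin k → ℂ)).toLinearMap ≤
              (W.comap (b.equivFun : V ≃ₗ[ℂ] (Fin k → ℂ)).toLinearMap).comap (T g) := by
            intro g v hv
            rw [Submodule.mem_comap] at hv ⊢
            rw [Submodule.mem_comap]
            have h2 := LinearMap.congr_fun (hconj g) v
            simp only [LinearMap.coe_comp, LinearEquiv.coe_coe, Function.comp_apply] at h2
            rw [LinearEquiv.coe_coe, h2]
            exact hW g hv
          have hmap : (W.comap (b.equivFun : V ≃ₗ[ℂ] (Fin k → ℂ)).toLinearMap).map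
              (b.equivFun : V ≃ₗ[ℂ] (Fin k → ℂ)).toLinearMap = W :=
            Submodule.map_comap_eq_of_surjective b.equivFun.surjective W
          rcases hirr _ hWc with h | h
          · left; rw [← hmap, h, Submodule.map_bot]
          · right; rw [← hmap, h, Submodule.map_top, LinearEquiv.range]
        have hkerV : ∀ g, φ g = 1 → ∃ c : ℂ, c ^ m₀ = 1 ∧
            (ρV g : Matrix (Fin k) (Fin k) ℂ) = c • (1 : Matrix (Fin k) (Fin k) ℂ) := by
          intro g hg
          obtain ⟨c, hc, hTg⟩ := hsc g hg
          refine ⟨c, hc, ?_⟩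
          rw [hρV, hTg, map_smul, LinearMap.toMatrix_id]
        -- CHANGE: the irreducible block by `retractD_of_budget`; its small regime is excluded
        rcases retractD_of_budget n m₀ k B G φ ρV hφ hkerV (hk ▸ hM) hirr'
            (fun hk1 σA => hY k hk1 (hk ▸ hM) σA) with hsm | ⟨m', hm', ιM, pM, τ, hpι, hrel⟩
        · exact absurd hsm hlarge
        -- matrix retract → linear retract on coordinates
        have hpιL : Matrix.toLin' pM ∘ₗ Matrix.toLin' ιM = LinearMap.id := by
          rw [← Matrix.toLin'_mul, hpι, Matrix.toLin'_one]
        have hrelL : ∀ g, LinearMap.funLeft ℂ ℂ (τ g) ∘ₗ Matrix.toLin' ιM =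
            Matrix.toLin' ιM ∘ₗ Matrix.toLin' (ρV g : Matrix (Fin k) (Fin k) ℂ) ∧
            Matrix.toLin' pM ∘ₗ LinearMap.funLeft ℂ ℂ (τ g) =
              Matrix.toLin' (ρV g : Matrix (Fin k) (Fin k) ℂ) ∘ₗ Matrix.toLin' pM := by
          intro g
          rw [← toLin'_permMatrix, ← Matrix.toLin'_mul, ← Matrix.toLin'_mul, ← Matrix.toLin'_mul,
            ← Matrix.toLin'_mul, (hrel g).1, (hrel g).2]
          exact ⟨rfl, rfl⟩
        -- transport to `V`
        obtain ⟨h1, h2⟩ := linRetract_of_equiv (fun g => Matrix.toLin' (ρV g : Matrix (Fin k) (Fin k) ℂ))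
          (fun g => T g) b.equivFun.symm hconj' (Matrix.toLin' ιM) (Matrix.toLin' pM) τ hpιL hrelL
        refine ⟨m', _, _, τ, ?_, h1, h2⟩
        have hk1 : 1 ≤ k := by omega
        calc m' ≤ Bd := hm'
          _ = 1 * Bd := (one_mul _).symm
          _ ≤ k * Bd := Nat.mul_le_mul_right _ hk1
      · -- reducible: split along a Maschke complement
        push Not at hirr
        obtain ⟨W, hWinv, hWbot, hWtop⟩ := hirr
        obtain ⟨W', hcW, hW'inv⟩ := exists_invariant_compl T hWinv
        -- the restricted homomorphisms
        let TW : G →* (W →ₗ[ℂ] W) :=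
          { toFun := fun g => (T g).restrict (hWinv g)
            map_one' := by
              refine LinearMap.ext fun w => Subtype.ext ?_
              simp [LinearMap.coe_restrict_apply]
            map_mul' := fun a c => by
              refine LinearMap.ext fun w => Subtype.ext ?_
              simp [LinearMap.coe_restrict_apply, Module.End.mul_apply] }
        let TW' : G →* (W' →ₗ[ℂ] W') :=
          { toFun := fun g => (T g).restrict (hW'inv g)
            map_one' := by
              refine LinearMap.ext fun w => Subtype.ext ?_
              simp [LinearMap.coe_restrict_apply]
            map_mul' := fun a c => by
              refine LinearMap.ext fun w => Subtype.ext ?_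
              simp [LinearMap.coe_restrict_apply, Module.End.mul_apply] }
        have hTW : ∀ g, TW g = (T g).restrict (hWinv g) := fun g => rfl
        have hTW' : ∀ g, TW' g = (T g).restrict (hW'inv g) := fun g => rfl
        -- dimensions
        have hsum : Module.finrank ℂ W + Module.finrank ℂ W' = Module.finrank ℂ V := by
          have := Submodule.finrank_sup_add_finrank_inf_eq W W'
          rw [hcW.sup_eq_top, hcW.inf_eq_bot, finrank_top, finrank_bot, add_zero] at this
          exact this.symm
        have hdW : Module.finrank ℂ W < Module.finrank ℂ V :=
          Submodule.finrank_lt hWtop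
        have hW'top : W' ≠ ⊤ := by
          intro h
          apply hWbot
          have := hcW.inf_eq_bot
          rwa [h, inf_top_eq] at this
        have hdW' : Module.finrank ℂ W' < Module.finrank ℂ V :=
          Submodule.finrank_lt hW'top
        -- scalars on the kernel restrict
        have hscW : ∀ g, φ g = 1 → ∃ c : ℂ, c ^ m₀ = 1 ∧ TW g = c • LinearMap.id := by
          intro g hg
          obtain ⟨c, hc, hTg⟩ := hsc g hg
          refine ⟨c, hc, LinearMap.ext fun w => Subtype.ext ?_⟩
          simp [hTW, LinearMap.coe_restrict_apply, hTg]
        have hscW' : ∀ g, φ g = 1 → ∃ c : ℂ, c ^ m₀ = 1 ∧ TW' g = c • LinearMap.id := by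
          intro g hg
          obtain ⟨c, hc, hTg⟩ := hsc g hg
          refine ⟨c, hc, LinearMap.ext fun w => Subtype.ext ?_⟩
          simp [hTW', LinearMap.coe_restrict_apply, hTg]
        obtain ⟨a, ι₁, p₁, τ₁, ha, hpι₁, hr₁⟩ := ih W TW (by omega) (by omega) hscW
        obtain ⟨a', ι₂, p₂, τ₂, ha', hpι₂, hr₂⟩ := ih W' TW' (by omega) (by omega) hscW'
        obtain ⟨ι, p, τ, hpι, hr⟩ := linRetract_sum (fun g => T g) hcW hWinv hW'inv
          ι₁ p₁ τ₁ hpι₁ (fun g => hr₁ g) ι₂ p₂ τ₂ hpι₂ (fun g => hr₂ g)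
        obtain ⟨ι', p', τ', hpι', hr'⟩ := linRetract_reindex finSumFinEquiv (fun g => T g) ι p τ hpι hr
        refine ⟨a + a', ι', p', τ', ?_, hpι', hr'⟩
        calc a + a' ≤ Module.finrank ℂ W * Bd + Module.finrank ℂ W' * Bd := add_le_add ha ha'
          _ = Module.finrank ℂ V * Bd := by rw [← add_mul, hsum]
  -- apply to `ℂ^{m₀}` with `T g = ρ g`
  let T : G →* ((Fin m₀ → ℂ) →ₗ[ℂ] (Fin m₀ → ℂ)) :=
    { toFun := fun g => Matrix.toLin' (ρ g : Matrix (Fin m₀) (Fin m₀) ℂ)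
      map_one' := by simp only [map_one, Units.val_one, Matrix.toLin'_one]; rfl
      map_mul' := fun a c => by
        simp only [map_mul, Units.val_mul, Matrix.toLin'_mul]; rfl }
  have hT : ∀ g, T g = Matrix.toLin' (ρ g : Matrix (Fin m₀) (Fin m₀) ℂ) := fun g => rfl
  have hscT : ∀ g, φ g = 1 → ∃ c : ℂ, c ^ m₀ = 1 ∧ T g = c • LinearMap.id := by
    intro g hg
    obtain ⟨c, hc, hρg⟩ := hkerM g hg
    refine ⟨c, hc, ?_⟩
    rw [hT, hρg, map_smul, Matrix.toLin'_one]
  obtain ⟨m', ι, p, τ, hm', hpι, hr⟩ :=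
    key m₀ (Fin m₀ → ℂ) T (by rw [Module.finrank_fin_fun]) (by rw [Module.finrank_fin_fun]) hscT
  rw [Module.finrank_fin_fun] at hm'
  refine ⟨m', hm', LinearMap.toMatrix' ι, LinearMap.toMatrix' p, τ, ?_, fun g => ⟨?_, ?_⟩⟩
  · rw [← LinearMap.toMatrix'_comp, hpι, LinearMap.toMatrix'_id]
  · have hperm : (τ g).permMatrix ℂ = LinearMap.toMatrix' (LinearMap.funLeft ℂ ℂ (τ g)) := by
      rw [← toLin'_permMatrix, LinearMap.toMatrix'_toLin']
    rw [hperm, ← LinearMap.toMatrix'_comp, (hr g).1, LinearMap.toMatrix'_comp, hT,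
      LinearMap.toMatrix'_toLin']
  · have hperm : (τ g).permMatrix ℂ = LinearMap.toMatrix' (LinearMap.funLeft ℂ ℂ (τ g)) := by
      rw [← toLin'_permMatrix, LinearMap.toMatrix'_toLin']
    rw [hperm, ← LinearMap.toMatrix'_comp, (hr g).2, LinearMap.toMatrix'_comp, hT,
      LinearMap.toMatrix'_toLin']

/-- **(iii′)_Δ at budget `B`.**  Transcription of `permEmbeddingQP_diag`: INFLATION — apply
`retract_of_budget` to `G × 𝔖_n ↠ 𝔖_n × 𝔖_n`, `(x, κ) ↦ (pr x, κ)`, `ρ (x, κ) = x.2`, where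
`G = {(σ, g) : ((σ, σ), g) ∈ F}` is finite (`finite_liftGroup_of_scalar_fibre`) and the kernel acts by
scalars; the small-regime disjunct is carried. [folklore; transcription] -/
theorem diagRetract_of_budget (n m₀ B : ℕ)
    (F : Subgroup ((Equiv.Perm (Fin n) × Equiv.Perm (Fin n)) × GL (Fin m₀) ℂ))
    (hsurj : ∀ σ : Equiv.Perm (Fin n), ∃ g : GL (Fin m₀) ℂ, ((σ, σ), g) ∈ F)
    (hscal : ∀ g : GL (Fin m₀) ℂ, ((1 : Equiv.Perm (Fin n) × Equiv.Perm (Fin n)), g) ∈ F →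
      ∃ c : ℂ, (g : Matrix (Fin m₀) (Fin m₀) ℂ) = c • (1 : Matrix (Fin m₀) (Fin m₀) ℂ))
    (hdet : ∀ x ∈ F, Matrix.det (x.2 : Matrix (Fin m₀) (Fin m₀) ℂ) = 1)
    (hY : ∀ k : ℕ, 1 ≤ k → k ≤ m₀ →
      ∀ σ : ↥(alternatingGroup (Fin n)) × ↥(alternatingGroup (Fin n)) →* GL (Fin k) ℂ,
      ∃ Y : Subgroup (↥(alternatingGroup (Fin n)) × ↥(alternatingGroup (Fin n))),
        Y.index ≤ B ∧ ∃ ℓ : (Fin k → ℂ) →ₗ[ℂ] ℂ, ℓ ≠ 0 ∧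
          ∀ y ∈ Y, ℓ ∘ₗ Matrix.toLin' (σ y : Matrix (Fin k) (Fin k) ℂ) = ℓ) :
    n ≤ 4 * (Nat.log 2 m₀ + 1) ∨ ∃ m' ≤ m₀ * (4 * m₀ * B),
      ∃ (ι : Matrix (Fin m') (Fin m₀) ℂ) (p : Matrix (Fin m₀) (Fin m') ℂ)
        (τ : (Equiv.Perm (Fin n) × Equiv.Perm (Fin n)) × GL (Fin m₀) ℂ → Equiv.Perm (Fin m')),
        p * ι = 1 ∧ ∀ (σ : Equiv.Perm (Fin n)) (g : GL (Fin m₀) ℂ), ((σ, σ), g) ∈ F →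
          (τ ((σ, σ), g)).permMatrix ℂ * ι = ι * (g : Matrix (Fin m₀) (Fin m₀) ℂ) ∧
          p * (τ ((σ, σ), g)).permMatrix ℂ = (g : Matrix (Fin m₀) (Fin m₀) ℂ) * p := by
  classical
  -- the diagonal part of the lift group, as a subgroup over `𝔖_n`
  let δ : Equiv.Perm (Fin n) →* Equiv.Perm (Fin n) × Equiv.Perm (Fin n) :=
    (MonoidHom.id (Equiv.Perm (Fin n))).prod (MonoidHom.id (Equiv.Perm (Fin n)))
  let G : Subgroup (Equiv.Perm (Fin n) × GL (Fin m₀) ℂ) :=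
    F.comap (δ.prodMap (MonoidHom.id (GL (Fin m₀) ℂ)))
  have hmemG : ∀ x : Equiv.Perm (Fin n) × GL (Fin m₀) ℂ, x ∈ G ↔ ((x.1, x.1), x.2) ∈ F :=
    fun x => Iff.rfl
  haveI : Finite G := finite_liftGroup_of_scalar_fibre G
    (fun g hg => hscal g ((hmemG (1, g)).1 hg)) (fun x hx => hdet _ ((hmemG x).1 hx))
  -- inflation: `G × 𝔖_n ↠ 𝔖_n × 𝔖_n`, the second factor acting trivially
  let φ : ↥G × Equiv.Perm (Fin n) →* Equiv.Perm (Fin n) × Equiv.Perm (Fin n) :=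
    ((MonoidHom.fst _ _).comp G.subtype).prodMap (MonoidHom.id (Equiv.Perm (Fin n)))
  let ρ : ↥G × Equiv.Perm (Fin n) →* GL (Fin m₀) ℂ :=
    ((MonoidHom.snd _ _).comp G.subtype).comp (MonoidHom.fst _ _)
  have hφapp : ∀ x : ↥G × Equiv.Perm (Fin n),
      φ x = ((x.1 : Equiv.Perm (Fin n) × GL (Fin m₀) ℂ).1, x.2) := fun x => rfl
  have hρapp : ∀ x : ↥G × Equiv.Perm (Fin n),
      ρ x = (x.1 : Equiv.Perm (Fin n) × GL (Fin m₀) ℂ).2 := fun x => rfl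
  have hφs : Function.Surjective φ := by
    rintro ⟨σ, κ⟩
    obtain ⟨g, hg⟩ := hsurj σ
    exact ⟨(⟨(σ, g), (hmemG (σ, g)).2 hg⟩, κ), rfl⟩
  have hker : ∀ x : ↥G × Equiv.Perm (Fin n), φ x = 1 →
      ∃ c : ℂ, (ρ x : Matrix (Fin m₀) (Fin m₀) ℂ) = c • (1 : Matrix (Fin m₀) (Fin m₀) ℂ) := by
    intro x hx
    rw [hφapp, Prod.mk_eq_one] at hx
    rw [hρapp]
    apply hscal
    have hmem : (((x.1 : Equiv.Perm (Fin n) × GL (Fin m₀) ℂ).1,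
        (x.1 : Equiv.Perm (Fin n) × GL (Fin m₀) ℂ).1),
        (x.1 : Equiv.Perm (Fin n) × GL (Fin m₀) ℂ).2) ∈ F := (hmemG _).1 x.1.2
    rw [hx.1] at hmem
    exact hmem
  have hdet' : ∀ x : ↥G × Equiv.Perm (Fin n), Matrix.det (ρ x : Matrix (Fin m₀) (Fin m₀) ℂ) = 1 :=
    fun x => hdet _ ((hmemG _).1 x.1.2)
  rcases retract_of_budget n m₀ B (↥G × Equiv.Perm (Fin n)) φ ρ hφs hker hdet' hY with
    hsm | ⟨m', hm', ι, p, τ, hpι, hrel⟩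
  · exact Or.inl hsm
  refine Or.inr ⟨m', hm', ι, p, fun x => if hx : ((x.1.1, x.1.1), x.2) ∈ F then
    τ (⟨(x.1.1, x.2), (hmemG (x.1.1, x.2)).2 hx⟩, 1) else 1, hpι, fun σ g hg => ?_⟩
  dsimp only
  rw [dif_pos hg]
  exact hrel (⟨(σ, g), (hmemG (σ, g)).2 hg⟩, 1)

end Summit.ValiantsHypothesis.ValiantsHypothesis.Theorems.EquivariantDialThresholdPermify

end
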